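import Literature.Analysis.FluidPDE.SereginZajaczkowski2007Swirl
import HarnessLib

/-!
# Seregin–Zajaczkowski 2007, Lemma 4.3 from (4.17) and (4.18): the proofs

G. Seregin, W. Zajaczkowski, *A sufficient condition of regularity for axially symmetric
solutions to the Navier–Stokes equations*, SIAM J. Math. Anal. 39 (2007) 669–685 =
arXiv:math/0702720, §4 (arXiv numbering). Companion to `SereginZajaczkowski2007Swirl.lean`,
which proves the multiplicative inequality (4.17) (`lintegral_rpow_tenThirds_le_of_contDiff`),
vendors (4.18) as the named fact `SwirlL4EnergyBound` and constructs the model cut-off `psi0`.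
This file PROVES Lemma 4.3 (the sibling named fact `OffAxisSwirlL6Bound`,
`SereginZajaczkowski2007L6.lean`) from them, i.e. the printed sentence "So, (4.14) follows from
(4.17) and (4.18). Lemma 4.3 is proved.":

* geometry `Q̃₂ ⊆ Q̃₁ ⊆ Q̃`, `|Q̃₂| < ∞`;
* the pointwise step on `Q̃₂` (`ψ₀ = 1`, `ϱ > 3/8`): `|V_φ|⁶ ≤ (8/3)⁶ β̃³`
  (`swirlVelocity_pow_six_le`) and `b³ ≤ 1 + b^{10/3}` (`pow_three_le_one_add_rpow`, the passage
  from the exponent `20/3` of `α̃` to the exponent `6` of (4.14) on a set of finite measure);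
* regularity of `β̃ = (ψ Γ(V))²` for the class `IsSmoothAxisymmetricSolutionOn Q̃ V P`:
  `hasFDerivAt_betaTilde` (derivative `betaTildeFDeriv`), `continuousOn_fderiv_betaTilde`
  (all spatial derivatives of `V` are continuous in space–time), `contDiff_betaTilde` (each slice
  `β̃(t, ·)`, `-(7/4)² < t < 0`, is `C¹` on `ℝ³`: smooth at the points of `𝒞̃`, zero near every
  other point), `hasCompactSupport_betaTilde`, `tsupport_betaTilde_subset`;
* `setLIntegral_betaTilde_rpow_le`: (4.17) on each slice, all integrals on `𝒞̃₁`;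
* `offAxisSwirlL6Bound_of_swirlL4EnergyBound : SwirlL4EnergyBound → OffAxisSwirlL6Bound`:
  (4.17) slice-wise with `(∫_{𝒞̃₁} β̃²)^{2/3} ≤ Φ₅^{2/3}` from the sup part of (4.18), Tonelli in
  `t` and the gradient part of (4.18) give `∫_{Q̃₁} β̃^{10/3} ≤ c Φ₅^{2/3} Φ₅`; with the pointwise
  step, `∫_{Q̃₂} |V_φ|⁶ dz ≤ (8/3)⁶ (|Q̃₂| + c Φ₅(K)^{2/3} Φ₅(K))`, non-decreasing in `K ≥ 𝒜₂`.

## References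

* G. Seregin, W. Zajaczkowski, SIAM J. Math. Anal. 39 (2007) 669–685, arXiv:math/0702720, §4:
  Lemma 4.3 ((4.14)) and its proof ((4.17), (4.18), last sentence). [`SereginZajaczkowski2007`]
-/

noncomputable section

open MeasureTheory Set Function Filter Topology TopologicalSpace Metric WithLp Module
open scoped NNReal ENNReal ContDiff InnerProductSpace RealInnerProductSpace

namespace Literature.Analysis.FluidPDE

namespace SereginZajaczkowski2007

open SereginSverak2009

/-- Local notation for physical space `ℝ³ = EuclideanSpace ℝ (Fin 3)`. -/
local notation "ℝ³" => EuclideanSpace ℝ (Fin 3)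

/-! ### Geometry of `Q̃ ⊇ Q̃₁ ⊇ Q̃₂` -/

/-- `Q̃₂ ⊆ Q̃₁`. [cite: SereginZajaczkowski2007, Lemma 4.3 (the sets Q̃₁, Q̃₂)] -/
theorem shellCyl_two_subset_one' :
    shellCyl (3 / 8) (5 / 2) (3 / 2) (3 / 2) ⊆ shellCyl (5 / 16) (11 / 4) (7 / 4) (7 / 4) :=
  shellCyl_mono (by norm_num) (by norm_num) (by norm_num) (by norm_num) (by norm_num)

/-- `Q̃₁ ⊆ Q̃`. [cite: SereginZajaczkowski2007, Lemma 4.2 (the sets Q̃, Q̃₁)] -/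
theorem shellCyl_one_subset_tilde' :
    shellCyl (5 / 16) (11 / 4) (7 / 4) (7 / 4) ⊆ shellCyl (1 / 4) 3 2 2 :=
  shellCyl_mono (by norm_num) (by norm_num) (by norm_num) (by norm_num) (by norm_num)

/-- `𝒞̃₁ ⊆ 𝒞̃`. [cite: SereginZajaczkowski2007, Lemma 4.2 (the sets 𝒞̃, 𝒞̃₁)] -/
theorem shell_one_subset_tilde : shell (5 / 16) (11 / 4) (7 / 4) ⊆ shell (1 / 4) 3 2 := by
  intro x hx
  rw [mem_shell] at hx ⊢
  exact ⟨⟨by linarith [hx.1.1], by linarith [hx.1.2]⟩, by linarith [hx.2]⟩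

/-- A time in `]-(7/4)², 0[` and a point of `𝒞̃₁` give a point of `Q̃`. [folklore] -/
theorem mk_mem_shellCyl_tilde {t : ℝ} (ht : t ∈ Ioo (-(7 / 4 : ℝ) ^ 2) 0) {x : ℝ³}
    (hx : x ∈ shell (5 / 16) (11 / 4) (7 / 4)) : (t, x) ∈ shellCyl (1 / 4) 3 2 2 :=
  ⟨⟨by linarith [ht.1], ht.2⟩, shell_one_subset_tilde hx⟩

/-- `Q̃₂` has finite measure (it is bounded). [folklore] -/
theorem volume_shellCyl_two_ne_top : volume (shellCyl (3 / 8) (5 / 2) (3 / 2) (3 / 2)) ≠ ⊤ := by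
  have hsub : shellCyl (3 / 8) (5 / 2) (3 / 2) (3 / 2) ⊆
      Ioo (-(3 / 2 : ℝ) ^ 2) 0 ×ˢ closedBall (0 : ℝ³) 3 := by
    intro z hz
    rw [mem_shellCyl] at hz
    refine ⟨hz.1, ?_⟩
    rw [mem_closedBall, dist_zero_right, EuclideanSpace.norm_eq]
    simp only [Fin.sum_univ_three, Real.norm_eq_abs, sq_abs]
    have hr := cylRadius_sq z.2
    have h3 : z.2 2 ^ 2 < (3 / 2) ^ 2 := by
      have := abs_lt.1 hz.2.2
      nlinarith
    rw [show (3 : ℝ) = Real.sqrt 9 by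
      rw [show (9 : ℝ) = 3 ^ 2 by norm_num, Real.sqrt_sq (by norm_num)]]
    exact Real.sqrt_le_sqrt (by nlinarith [hz.2.1.2, cylRadius_nonneg z.2])
  refine ne_top_of_le_ne_top ?_ (measure_mono hsub)
  rw [Measure.volume_eq_prod, Measure.prod_prod]
  exact ENNReal.mul_ne_top (by rw [Real.volume_Ioo]; exact ENNReal.ofReal_ne_top)
    measure_closedBall_lt_top.ne

/-! ### Pointwise: `|V_φ|⁶ ≤ (8/3)⁶ β̃³` on `Q̃₂` and `b³ ≤ 1 + b^{10/3}` -/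

/-- `|y|⁶ = y⁶`. [folklore] -/
theorem abs_pow_six (y : ℝ) : |y| ^ 6 = y ^ 6 :=
  Even.pow_abs ⟨3, rfl⟩ y

/-- `|y|⁶ = (y²)³`. [folklore] -/
theorem abs_pow_six_eq_sq_pow_three (y : ℝ) : |y| ^ 6 = (y ^ 2) ^ 3 := by
  rw [← sq_abs y, ← pow_mul]

/-- On `Q̃₂`, where `ψ = 1` and `ϱ > 3/8`: `|V_φ|⁶ = |α̃|⁶ / ϱ⁶ ≤ (8/3)⁶ β̃³`.
[cite: SereginZajaczkowski2007, proof of Lemma 4.3 ("(4.14) follows from (4.17) and (4.18)")] -/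
theorem swirlVelocity_pow_six_le {ψ : ℝ × ℝ³ → ℝ} {V : ℝ → ℝ³ → ℝ³} {z : ℝ × ℝ³}
    (hz : z ∈ shellCyl (3 / 8) (5 / 2) (3 / 2) (3 / 2)) (hψ : ψ z = 1) :
    swirlVelocity (V z.1) z.2 ^ 6 ≤ (8 / 3 : ℝ) ^ 6 * betaTilde ψ V z.1 z.2 ^ 3 := by
  rw [mem_shellCyl] at hz
  have hr : 3 / 8 < cylRadius z.2 := hz.2.1.1
  have hrpos : 0 < cylRadius z.2 := lt_trans (by norm_num) hr
  have hs := swirl_eq_cylRadius_mul_swirlVelocity (V z.1) hrpos.ne'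
  have hb : betaTilde ψ V z.1 z.2 = swirl (V z.1) z.2 ^ 2 := by
    rw [betaTilde, alphaTilde, show (z.1, z.2) = z from rfl, hψ, one_mul]
  rw [hb, hs]
  have h1 : |swirlVelocity (V z.1) z.2| ≤ 8 / 3 * |cylRadius z.2 * swirlVelocity (V z.1) z.2| := by
    rw [abs_mul, abs_of_pos hrpos]
    have ha := abs_nonneg (swirlVelocity (V z.1) z.2)
    nlinarith
  have h2 := pow_le_pow_left₀ (abs_nonneg _) h1 6
  rw [mul_pow] at h2
  calc swirlVelocity (V z.1) z.2 ^ 6 = |swirlVelocity (V z.1) z.2| ^ 6 := (abs_pow_six _).symm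
    _ ≤ (8 / 3 : ℝ) ^ 6 * |cylRadius z.2 * swirlVelocity (V z.1) z.2| ^ 6 := h2
    _ = (8 / 3 : ℝ) ^ 6 * ((cylRadius z.2 * swirlVelocity (V z.1) z.2) ^ 2) ^ 3 := by
        rw [abs_pow_six_eq_sq_pow_three]

/-- `b³ ≤ 1 + b^{10/3}` in `[0, ∞]` (the passage from the exponent `20/3` of `α̃` given by
(4.17)–(4.18) down to the exponent `6` of (4.14), on a set of finite measure). [folklore] -/
theorem pow_three_le_one_add_rpow (b : ℝ≥0∞) : b ^ 3 ≤ 1 + b ^ (10 / 3 : ℝ) := by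
  by_cases hb : b ≤ 1
  · exact (pow_le_one₀ (zero_le) hb).trans le_self_add
  · have hb' : 1 ≤ b := (not_le.1 hb).le
    calc b ^ 3 = b ^ ((3 : ℕ) : ℝ) := (ENNReal.rpow_natCast b 3).symm
      _ ≤ b ^ (10 / 3 : ℝ) := ENNReal.rpow_le_rpow_of_exponent_le hb' (by norm_num)
      _ ≤ 1 + b ^ (10 / 3 : ℝ) := le_add_self

/-! ### Regularity of `β̃` for the smooth class -/

section Regularity

variable {ψ : ℝ × ℝ³ → ℝ} {V : ℝ → ℝ³ → ℝ³} {P : ℝ → ℝ³ → ℝ}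

/-- At the points of `Q̃`, `β̃(t, ·)` is differentiable with derivative `betaTildeFDeriv`.
[folklore] -/
theorem hasFDerivAt_betaTilde (hψ : ContDiff ℝ ∞ ψ)
    (hV : IsSmoothAxisymmetricSolutionOn (shellCylOpens (1 / 4) 3 2 2) V P) {z : ℝ × ℝ³}
    (hz : z ∈ shellCyl (1 / 4) 3 2 2) :
    HasFDerivAt (betaTilde ψ V z.1) (betaTildeFDeriv ψ V z) z.2 := by
  have hVd : HasFDerivAt (V z.1) (fderiv ℝ (V z.1) z.2) z.2 := (hV.differentiableAt hz).hasFDerivAt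
  have hα : HasFDerivAt (alphaTilde ψ V z.1)
      (ψ z • swirlFDeriv z.2 (V z.1 z.2) (fderiv ℝ (V z.1) z.2) +
        swirl (V z.1) z.2 • sliceFDeriv ψ z) z.2 :=
    (hasFDerivAt_slice hψ z.1 z.2).mul (hasFDerivAt_swirl hVd)
  refine (hα.pow 2).congr_fderiv ?_
  rw [betaTildeFDeriv, pow_one, nsmul_eq_mul, Nat.cast_ofNat]

/-- `Γ(V)` is continuous on `Q̃` in space–time. [folklore] -/
theorem continuousOn_swirl (hV : IsSmoothAxisymmetricSolutionOn (shellCylOpens (1 / 4) 3 2 2) V P) :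
    ContinuousOn (fun z : ℝ × ℝ³ => swirl (V z.1) z.2) (shellCyl (1 / 4) 3 2 2) := by
  have hVc : ContinuousOn (fun z : ℝ × ℝ³ => V z.1 z.2) (shellCyl (1 / 4) 3 2 2) :=
    hV.continuousOn_velocity
  have h0 : ContinuousOn (fun z : ℝ × ℝ³ => V z.1 z.2 0) (shellCyl (1 / 4) 3 2 2) :=
    (EuclideanSpace.proj (0 : Fin 3)).continuous.comp_continuousOn hVc
  have h1 : ContinuousOn (fun z : ℝ × ℝ³ => V z.1 z.2 1) (shellCyl (1 / 4) 3 2 2) :=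
    (EuclideanSpace.proj (1 : Fin 3)).continuous.comp_continuousOn hVc
  have hx0 : Continuous fun z : ℝ × ℝ³ => z.2 0 :=
    (EuclideanSpace.proj (0 : Fin 3)).continuous.comp continuous_snd
  have hx1 : Continuous fun z : ℝ × ℝ³ => z.2 1 :=
    (EuclideanSpace.proj (1 : Fin 3)).continuous.comp continuous_snd
  exact (hx0.continuousOn.mul h1).sub (hx1.continuousOn.mul h0)

/-- `α̃` is continuous on `Q̃` in space–time. [folklore] -/
theorem continuousOn_alphaTilde (hψ : ContDiff ℝ ∞ ψ)
    (hV : IsSmoothAxisymmetricSolutionOn (shellCylOpens (1 / 4) 3 2 2) V P) :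
    ContinuousOn (fun z : ℝ × ℝ³ => alphaTilde ψ V z.1 z.2) (shellCyl (1 / 4) 3 2 2) := by
  unfold alphaTilde
  exact (hψ.continuous.continuousOn).mul (continuousOn_swirl hV)

/-- The explicit derivative `betaTildeFDeriv` is continuous on `Q̃` in space–time (all spatial
derivatives of `V` are continuous in space–time for the class). [folklore] -/
theorem continuousOn_betaTildeFDeriv (hψ : ContDiff ℝ ∞ ψ)
    (hV : IsSmoothAxisymmetricSolutionOn (shellCylOpens (1 / 4) 3 2 2) V P) :
    ContinuousOn (betaTildeFDeriv ψ V) (shellCyl (1 / 4) 3 2 2) := by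
  have hVc : ContinuousOn (fun z : ℝ × ℝ³ => V z.1 z.2) (shellCyl (1 / 4) 3 2 2) :=
    hV.continuousOn_velocity
  have hDc : ContinuousOn (fun z : ℝ × ℝ³ => fderiv ℝ (V z.1) z.2) (shellCyl (1 / 4) 3 2 2) :=
    hV.continuousOn_fderiv
  have htriple : ContinuousOn (fun z : ℝ × ℝ³ => (z.2, V z.1 z.2, fderiv ℝ (V z.1) z.2))
      (shellCyl (1 / 4) 3 2 2) :=
    continuousOn_snd.prodMk (hVc.prodMk hDc)
  have hsw : ContinuousOn (fun z : ℝ × ℝ³ => swirlFDeriv z.2 (V z.1 z.2) (fderiv ℝ (V z.1) z.2))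
      (shellCyl (1 / 4) 3 2 2) :=
    Continuous.comp_continuousOn
      (g := fun p : ℝ³ × ℝ³ × (ℝ³ →L[ℝ] ℝ³) => swirlFDeriv p.1 p.2.1 p.2.2)
      (f := fun z : ℝ × ℝ³ => (z.2, V z.1 z.2, fderiv ℝ (V z.1) z.2))
      continuous_swirlFDeriv htriple
  have hsl : Continuous (sliceFDeriv ψ) :=
    (hψ.continuous_fderiv (by simp)).clm_comp continuous_const
  have hL : ContinuousOn (fun z : ℝ × ℝ³ => ψ z • swirlFDeriv z.2 (V z.1 z.2) (fderiv ℝ (V z.1) z.2) +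
      swirl (V z.1) z.2 • sliceFDeriv ψ z) (shellCyl (1 / 4) 3 2 2) :=
    (hψ.continuous.continuousOn.smul hsw).add ((continuousOn_swirl hV).smul hsl.continuousOn)
  have h2 : ContinuousOn (fun z : ℝ × ℝ³ => 2 * alphaTilde ψ V z.1 z.2) (shellCyl (1 / 4) 3 2 2) :=
    continuousOn_const.mul (continuousOn_alphaTilde hψ hV)
  exact h2.smul hL

/-- **`∇ₓβ̃` is continuous on `Q̃` in space–time.** [folklore] -/
theorem continuousOn_fderiv_betaTilde (hψ : ContDiff ℝ ∞ ψ)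
    (hV : IsSmoothAxisymmetricSolutionOn (shellCylOpens (1 / 4) 3 2 2) V P) :
    ContinuousOn (fun z : ℝ × ℝ³ => fderiv ℝ (betaTilde ψ V z.1) z.2) (shellCyl (1 / 4) 3 2 2) :=
  (continuousOn_betaTildeFDeriv hψ hV).congr fun _ hz => (hasFDerivAt_betaTilde hψ hV hz).fderiv

/-- `β̃` is continuous on `Q̃` in space–time. [folklore] -/
theorem continuousOn_betaTilde (hψ : ContDiff ℝ ∞ ψ)
    (hV : IsSmoothAxisymmetricSolutionOn (shellCylOpens (1 / 4) 3 2 2) V P) :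
    ContinuousOn (fun z : ℝ × ℝ³ => betaTilde ψ V z.1 z.2) (shellCyl (1 / 4) 3 2 2) :=
  (continuousOn_alphaTilde hψ hV).pow 2

/-- Each slice `β̃(t, ·)`, `-(7/4)² < t < 0`, has compact support (inside the spatial support
of the cut-off). [folklore] -/
theorem hasCompactSupport_betaTilde (hψ : IsSwirlCutoff ψ) (t : ℝ) :
    HasCompactSupport (betaTilde ψ V t) := by
  obtain ⟨C, hCc, -, hC0⟩ := hψ.space_support
  exact HasCompactSupport.intro hCc fun x hx => by simp [betaTilde, alphaTilde, hC0 t x hx]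

/-- The topological support of a slice lies in the spatial support of the cut-off. [folklore] -/
theorem tsupport_betaTilde_subset (hψ : IsSwirlCutoff ψ) (t : ℝ) :
    tsupport (betaTilde ψ V t) ⊆ shell (5 / 16) (11 / 4) (7 / 4) := by
  obtain ⟨C, hCc, hCsub, hC0⟩ := hψ.space_support
  refine (closure_minimal (fun x hx => ?_) hCc.isClosed).trans hCsub
  by_contra hxC
  exact hx (by simp [betaTilde, alphaTilde, hC0 t x hxC])

/-- **Each slice `β̃(t, ·)`, `-(7/4)² < t < 0`, is `C¹` on `ℝ³`** (smooth at the points of `𝒞̃`,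
zero near every other point). [folklore] -/
theorem contDiff_betaTilde (hψ : IsSwirlCutoff ψ)
    (hV : IsSmoothAxisymmetricSolutionOn (shellCylOpens (1 / 4) 3 2 2) V P) {t : ℝ}
    (ht : t ∈ Ioo (-(7 / 4 : ℝ) ^ 2) 0) : ContDiff ℝ 1 (betaTilde ψ V t) := by
  obtain ⟨C, hCc, hCsub, hC0⟩ := hψ.space_support
  rw [contDiff_iff_contDiffAt]
  intro x
  by_cases hx : x ∈ C
  · -- a point of `𝒞̃₁ ⊆ 𝒞̃`: smooth product
    have hz : (t, x) ∈ shellCyl (1 / 4) 3 2 2 := mk_mem_shellCyl_tilde ht (hCsub hx)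
    have hVx : ContDiffAt ℝ 1 (V t) x := (hV.contDiffAt (t, x) hz).of_le (by simp)
    have hψx : ContDiffAt ℝ 1 (fun y => ψ (t, y)) x :=
      ((hψ.contDiff.of_le (by simp)).comp (contDiff_prodMk_right t)).contDiffAt
    have hp : ∀ i : Fin 3, ContDiff ℝ 1 fun y : ℝ³ => y i := fun i =>
      (EuclideanSpace.proj i : ℝ³ →L[ℝ] ℝ).contDiff
    have hV0 : ContDiffAt ℝ 1 (fun y => V t y 0) x :=
      (EuclideanSpace.proj (0 : Fin 3) : ℝ³ →L[ℝ] ℝ).contDiff.contDiffAt.comp x hVx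
    have hV1 : ContDiffAt ℝ 1 (fun y => V t y 1) x :=
      (EuclideanSpace.proj (1 : Fin 3) : ℝ³ →L[ℝ] ℝ).contDiff.contDiffAt.comp x hVx
    have hsw : ContDiffAt ℝ 1 (swirl (V t)) x :=
      ((hp 0).contDiffAt.mul hV1).sub ((hp 1).contDiffAt.mul hV0)
    exact (hψx.mul hsw).pow 2
  · -- outside `C`: zero near `x`
    have hopen : IsOpen Cᶜ := hCc.isClosed.isOpen_compl
    have hev : betaTilde ψ V t =ᶠ[𝓝 x] fun _ => 0 := by
      filter_upwards [hopen.mem_nhds hx] with y hy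
      simp [betaTilde, alphaTilde, hC0 t y hy]
    exact contDiffAt_const.congr_of_eventuallyEq hev

end Regularity

/-! ### Lemma 4.3 from (4.17) and (4.18) -/

section Assembly

variable {ψ : ℝ × ℝ³ → ℝ} {V : ℝ → ℝ³ → ℝ³} {P : ℝ → ℝ³ → ℝ}

/-- **(4.17) for the slices of `β̃`**: for `-(7/4)² < t < 0`,
`∫_{𝒞̃₁} β̃^{10/3} dx ≤ c (∫_{𝒞̃₁} β̃² dx)^{2/3} ∫_{𝒞̃₁} |∇β̃|² dx` (the slice `β̃(t, ·)` is `C¹`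
with compact support in `𝒞̃₁`, so the whole-space inequality applies and all integrals live on
`𝒞̃₁`). [cite: SereginZajaczkowski2007, proof of Lemma 4.3, (4.17)] -/
theorem setLIntegral_betaTilde_rpow_le (hψ : IsSwirlCutoff ψ)
    (hV : IsSmoothAxisymmetricSolutionOn (shellCylOpens (1 / 4) 3 2 2) V P) {t : ℝ}
    (ht : t ∈ Ioo (-(7 / 4 : ℝ) ^ 2) 0) :
    ∫⁻ x in shell (5 / 16) (11 / 4) (7 / 4), ‖betaTilde ψ V t x‖ₑ ^ (10 / 3 : ℝ) ≤
      gnTenThirdsConst *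
        ((∫⁻ x in shell (5 / 16) (11 / 4) (7 / 4), ‖betaTilde ψ V t x‖ₑ ^ 2) ^ (2 / 3 : ℝ) *
          ∫⁻ x in shell (5 / 16) (11 / 4) (7 / 4), ‖fderiv ℝ (betaTilde ψ V t) x‖ₑ ^ 2) := by
  have h := lintegral_rpow_tenThirds_le_of_contDiff (contDiff_betaTilde hψ hV ht)
    (hasCompactSupport_betaTilde (V := V) hψ t)
  have hts := tsupport_betaTilde_subset (V := V) hψ t
  have h2 : ∫⁻ x, ‖betaTilde ψ V t x‖ₑ ^ 2 =
      ∫⁻ x in shell (5 / 16) (11 / 4) (7 / 4), ‖betaTilde ψ V t x‖ₑ ^ 2 := by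
    refine (setLIntegral_eq_of_support_subset fun x hx => hts (subset_tsupport _ ?_)).symm
    rw [mem_support] at hx ⊢
    intro h0
    exact hx (by simp [h0])
  have hD : ∫⁻ x, ‖fderiv ℝ (betaTilde ψ V t) x‖ₑ ^ 2 =
      ∫⁻ x in shell (5 / 16) (11 / 4) (7 / 4), ‖fderiv ℝ (betaTilde ψ V t) x‖ₑ ^ 2 := by
    refine (setLIntegral_eq_of_support_subset fun x hx => hts (support_fderiv_subset ℝ ?_)).symm
    rw [mem_support] at hx ⊢
    intro h0
    exact hx (by rw [h0, enorm_eq_nnnorm]; simp)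
  calc ∫⁻ x in shell (5 / 16) (11 / 4) (7 / 4), ‖betaTilde ψ V t x‖ₑ ^ (10 / 3 : ℝ)
      ≤ ∫⁻ x, ‖betaTilde ψ V t x‖ₑ ^ (10 / 3 : ℝ) := setLIntegral_le_lintegral _ _
    _ ≤ gnTenThirdsConst * ((∫⁻ x, ‖betaTilde ψ V t x‖ₑ ^ 2) ^ (2 / 3 : ℝ) *
          ∫⁻ x, ‖fderiv ℝ (betaTilde ψ V t) x‖ₑ ^ 2) := h
    _ = _ := by rw [h2, hD]

/-- `(8/3)⁶` in `[0, ∞]`: the real and the `ℝ≥0` spellings agree. [folklore] -/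
theorem ofReal_eight_thirds_pow_six :
    ENNReal.ofReal ((8 / 3 : ℝ) ^ 6) = (((8 / 3 : ℝ≥0) ^ 6 : ℝ≥0) : ℝ≥0∞) := by
  rw [← ENNReal.ofReal_coe_nnreal]
  norm_num

/-- **Seregin–Zajaczkowski 2007, Lemma 4.3 from (4.17) and (4.18)** ("So, (4.14) follows from
(4.17) and (4.18). Lemma 4.3 is proved."): given the `L⁴`-energy bound (4.18) for the cut-off
quantity `β̃ = |ϱ V_φ ψ|²` (the named fact `SwirlL4EnergyBound`, applied to the model cut-off
`psi0`), the multiplicative inequality (4.17) on each time slice (proved,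
`lintegral_rpow_tenThirds_le_of_contDiff`) and Tonelli give
`∫_{Q̃₁} β̃^{10/3} dz ≤ c Φ₅(𝒜₂)^{2/3} Φ₅(𝒜₂)`; on `Q̃₂ ⊆ Q̃₁` one has `ψ = 1` and `ϱ > 3/8`, so
`|V_φ|⁶ ≤ (8/3)⁶ β̃³ ≤ (8/3)⁶ (1 + β̃^{10/3})`, whence
`∫_{Q̃₂} |V_φ|⁶ dz ≤ (8/3)⁶ (|Q̃₂| + c Φ₅(𝒜₂)^{5/3}) =: Φ(𝒜₂)`, non-decreasing.
[cite: SereginZajaczkowski2007, Lemma 4.3 ((4.14)) and its proof, last sentence] -/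
theorem offAxisSwirlL6Bound_of_swirlL4EnergyBound (h : SwirlL4EnergyBound) :
    OffAxisSwirlL6Bound := by
  obtain ⟨Φ₅, hΦ₅, h18⟩ := h psi0 isSwirlCutoff_psi0
  have hMeq : (((volume (shellCyl (3 / 8) (5 / 2) (3 / 2) (3 / 2))).toNNReal : ℝ≥0) : ℝ≥0∞) =
      volume (shellCyl (3 / 8) (5 / 2) (3 / 2) (3 / 2)) :=
    ENNReal.coe_toNNReal volume_shellCyl_two_ne_top
  refine ⟨fun K => (8 / 3 : ℝ≥0) ^ 6 *
    ((volume (shellCyl (3 / 8) (5 / 2) (3 / 2) (3 / 2))).toNNReal +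
      gnTenThirdsConst * (Φ₅ K ^ (2 / 3 : ℝ) * Φ₅ K)), ?_, ?_⟩
  · intro K K' hKK'
    have h1 : Φ₅ K ≤ Φ₅ K' := hΦ₅ hKK'
    dsimp only
    gcongr
  intro V P hV K hK
  have h18' := h18 V P hV K hK
  have hsup : ∀ t ∈ Ioo (-(7 / 4 : ℝ) ^ 2) 0,
      ∫⁻ x in shell (5 / 16) (11 / 4) (7 / 4), ‖betaTilde psi0 V t x‖ₑ ^ 2 ≤ Φ₅ K := by
    intro t ht
    refine le_trans ?_ (le_trans le_self_add h18')
    exact le_iSup₂ (f := fun t (_ : t ∈ Ioo (-(7 / 4 : ℝ) ^ 2) 0) =>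
      ∫⁻ x in shell (5 / 16) (11 / 4) (7 / 4), ‖betaTilde psi0 V t x‖ₑ ^ 2) t ht
  have hgrad : ∫⁻ z in shellCyl (5 / 16) (11 / 4) (7 / 4) (7 / 4),
      ‖fderiv ℝ (betaTilde psi0 V z.1) z.2‖ₑ ^ 2 ≤ Φ₅ K := le_trans le_add_self h18'
  -- Step 1: the pointwise bound `|V_φ|⁶ ≤ (8/3)⁶ (1 + β̃^{10/3})` on `Q̃₂`
  have hpt : ∀ z ∈ shellCyl (3 / 8) (5 / 2) (3 / 2) (3 / 2),
      ‖swirlVelocity (V z.1) z.2‖ₑ ^ (6 : ℕ) ≤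
        ENNReal.ofReal ((8 / 3 : ℝ) ^ 6) * (1 + ‖betaTilde psi0 V z.1 z.2‖ₑ ^ (10 / 3 : ℝ)) := by
    intro z hz
    have hreal := swirlVelocity_pow_six_le (V := V) hz (psi0_eq_one hz)
    have hb0 : 0 ≤ betaTilde psi0 V z.1 z.2 := betaTilde_nonneg _ _ _ _
    calc ‖swirlVelocity (V z.1) z.2‖ₑ ^ (6 : ℕ)
        = ENNReal.ofReal (swirlVelocity (V z.1) z.2 ^ 6) := enorm_pow_six_eq_ofReal _
      _ ≤ ENNReal.ofReal ((8 / 3 : ℝ) ^ 6 * betaTilde psi0 V z.1 z.2 ^ 3) :=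
          ENNReal.ofReal_le_ofReal hreal
      _ = ENNReal.ofReal ((8 / 3 : ℝ) ^ 6) * ‖betaTilde psi0 V z.1 z.2‖ₑ ^ 3 := by
          rw [ENNReal.ofReal_mul (by positivity), ENNReal.ofReal_pow hb0,
            Real.enorm_eq_ofReal hb0]
      _ ≤ ENNReal.ofReal ((8 / 3 : ℝ) ^ 6) * (1 + ‖betaTilde psi0 V z.1 z.2‖ₑ ^ (10 / 3 : ℝ)) := by
          gcongr
          exact pow_three_le_one_add_rpow _
  -- Step 2: integrate over `Q̃₂`
  have hstep2 : ∫⁻ z in shellCyl (3 / 8) (5 / 2) (3 / 2) (3 / 2),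
      ‖swirlVelocity (V z.1) z.2‖ₑ ^ (6 : ℕ) ≤
      ENNReal.ofReal ((8 / 3 : ℝ) ^ 6) * (volume (shellCyl (3 / 8) (5 / 2) (3 / 2) (3 / 2)) +
        ∫⁻ z in shellCyl (3 / 8) (5 / 2) (3 / 2) (3 / 2),
          ‖betaTilde psi0 V z.1 z.2‖ₑ ^ (10 / 3 : ℝ)) := by
    calc ∫⁻ z in shellCyl (3 / 8) (5 / 2) (3 / 2) (3 / 2), ‖swirlVelocity (V z.1) z.2‖ₑ ^ (6 : ℕ)
        ≤ ∫⁻ z in shellCyl (3 / 8) (5 / 2) (3 / 2) (3 / 2),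
            ENNReal.ofReal ((8 / 3 : ℝ) ^ 6) * (1 + ‖betaTilde psi0 V z.1 z.2‖ₑ ^ (10 / 3 : ℝ)) :=
          setLIntegral_mono' (measurableSet_shellCyl _ _ _ _) hpt
      _ = _ := by
          rw [lintegral_const_mul' _ _ ENNReal.ofReal_ne_top, lintegral_add_left measurable_const,
            setLIntegral_one]
  -- Step 3: `∫_{Q̃₂} β̃^{10/3} ≤ ∫_{Q̃₁} β̃^{10/3} ≤ c Φ₅^{2/3} Φ₅` by (4.17) slice-wise and Tonelli
  have hstep3 : ∫⁻ z in shellCyl (3 / 8) (5 / 2) (3 / 2) (3 / 2),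
      ‖betaTilde psi0 V z.1 z.2‖ₑ ^ (10 / 3 : ℝ) ≤
      gnTenThirdsConst * ((Φ₅ K : ℝ≥0∞) ^ (2 / 3 : ℝ) * Φ₅ K) := by
    have hmeasD : AEMeasurable (fun z : ℝ × ℝ³ => ‖fderiv ℝ (betaTilde psi0 V z.1) z.2‖ₑ ^ 2)
        ((volume.restrict (Ioo (-(7 / 4 : ℝ) ^ 2) 0)).prod
          (volume.restrict (shell (5 / 16) (11 / 4) (7 / 4)))) := by
      rw [Measure.prod_restrict, ← Measure.volume_eq_prod, ← shellCyl_eq_prod]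
      have hc : ContinuousOn (fun z : ℝ × ℝ³ => fderiv ℝ (betaTilde psi0 V z.1) z.2)
          (shellCyl (5 / 16) (11 / 4) (7 / 4) (7 / 4)) :=
        (continuousOn_fderiv_betaTilde isSwirlCutoff_psi0.contDiff hV).mono
          shellCyl_one_subset_tilde'
      exact (hc.aemeasurable (measurableSet_shellCyl _ _ _ _)).enorm.pow_const _
    calc ∫⁻ z in shellCyl (3 / 8) (5 / 2) (3 / 2) (3 / 2),
          ‖betaTilde psi0 V z.1 z.2‖ₑ ^ (10 / 3 : ℝ)
        ≤ ∫⁻ z in shellCyl (5 / 16) (11 / 4) (7 / 4) (7 / 4),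
            ‖betaTilde psi0 V z.1 z.2‖ₑ ^ (10 / 3 : ℝ) := lintegral_mono_set shellCyl_two_subset_one'
      _ = ∫⁻ z, ‖betaTilde psi0 V z.1 z.2‖ₑ ^ (10 / 3 : ℝ)
            ∂((volume.restrict (Ioo (-(7 / 4 : ℝ) ^ 2) 0)).prod
              (volume.restrict (shell (5 / 16) (11 / 4) (7 / 4)))) := by
          rw [shellCyl_eq_prod, Measure.prod_restrict, ← Measure.volume_eq_prod]
      _ ≤ ∫⁻ t in Ioo (-(7 / 4 : ℝ) ^ 2) 0, ∫⁻ x in shell (5 / 16) (11 / 4) (7 / 4),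
            ‖betaTilde psi0 V t x‖ₑ ^ (10 / 3 : ℝ) := lintegral_prod_le _
      _ ≤ ∫⁻ t in Ioo (-(7 / 4 : ℝ) ^ 2) 0, gnTenThirdsConst * ((Φ₅ K : ℝ≥0∞) ^ (2 / 3 : ℝ) *
            ∫⁻ x in shell (5 / 16) (11 / 4) (7 / 4), ‖fderiv ℝ (betaTilde psi0 V t) x‖ₑ ^ 2) := by
          refine setLIntegral_mono' measurableSet_Ioo fun t ht => ?_
          refine (setLIntegral_betaTilde_rpow_le isSwirlCutoff_psi0 hV ht).trans ?_
          gcongr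
          exact hsup t ht
      _ = gnTenThirdsConst * ((Φ₅ K : ℝ≥0∞) ^ (2 / 3 : ℝ) *
            ∫⁻ t in Ioo (-(7 / 4 : ℝ) ^ 2) 0, ∫⁻ x in shell (5 / 16) (11 / 4) (7 / 4),
              ‖fderiv ℝ (betaTilde psi0 V t) x‖ₑ ^ 2) := by
          rw [lintegral_const_mul' _ _ ENNReal.coe_ne_top, lintegral_const_mul' _ _
            (ENNReal.rpow_ne_top_of_nonneg (by norm_num) ENNReal.coe_ne_top)]
      _ = gnTenThirdsConst * ((Φ₅ K : ℝ≥0∞) ^ (2 / 3 : ℝ) *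
            ∫⁻ z in shellCyl (5 / 16) (11 / 4) (7 / 4) (7 / 4),
              ‖fderiv ℝ (betaTilde psi0 V z.1) z.2‖ₑ ^ 2) := by
          rw [lintegral_lintegral hmeasD, shellCyl_eq_prod, Measure.prod_restrict,
            ← Measure.volume_eq_prod]
      _ ≤ gnTenThirdsConst * ((Φ₅ K : ℝ≥0∞) ^ (2 / 3 : ℝ) * Φ₅ K) := by gcongr
  -- assembling
  calc ∫⁻ z in shellCyl (3 / 8) (5 / 2) (3 / 2) (3 / 2), ‖swirlVelocity (V z.1) z.2‖ₑ ^ (6 : ℕ)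
      ≤ ENNReal.ofReal ((8 / 3 : ℝ) ^ 6) * (volume (shellCyl (3 / 8) (5 / 2) (3 / 2) (3 / 2)) +
          ∫⁻ z in shellCyl (3 / 8) (5 / 2) (3 / 2) (3 / 2),
            ‖betaTilde psi0 V z.1 z.2‖ₑ ^ (10 / 3 : ℝ)) := hstep2
    _ ≤ ENNReal.ofReal ((8 / 3 : ℝ) ^ 6) * (volume (shellCyl (3 / 8) (5 / 2) (3 / 2) (3 / 2)) +
          gnTenThirdsConst * ((Φ₅ K : ℝ≥0∞) ^ (2 / 3 : ℝ) * Φ₅ K)) := by gcongr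
    _ = (((8 / 3 : ℝ≥0) ^ 6 * ((volume (shellCyl (3 / 8) (5 / 2) (3 / 2) (3 / 2))).toNNReal +
          gnTenThirdsConst * (Φ₅ K ^ (2 / 3 : ℝ) * Φ₅ K)) : ℝ≥0) : ℝ≥0∞) := by
        rw [ofReal_eight_thirds_pow_six, ENNReal.coe_mul, ENNReal.coe_add, hMeq, ENNReal.coe_mul,
          ENNReal.coe_mul, ENNReal.coe_rpow_of_nonneg _ (by norm_num)]

end Assembly

end SereginZajaczkowski2007

end Literature.Analysis.FluidPDE
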